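import Mathlib
import Summits.Ventures.PercRepro2.Defs
import Summits.Ventures.PercRepro2.Independence
import Summits.Ventures.PercRepro2.Harris
import Summits.Ventures.PercRepro2.Graph
import Summits.Ventures.PercRepro2.Events
import Summits.Ventures.PercRepro2.PsiUniSure
import Summits.Ventures.PercRepro2.PsiUniExplored
import Summits.Ventures.PercRepro2.PsiTEdge
import Summits.Ventures.PercRepro2.R21OEdgeSGraph
import Summits.Ventures.PercRepro2.R21PinInduction
import Summits.Ventures.PercRepro2.R21TFrame
import Summits.Ventures.PercRepro2.R21SingleEdge

/-!
# The nested pin induction: (R2-1) for every mark assignment ⟸ (M2-o) (PercRepro2, p2)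

The predicate `Π(p) := ∀ marks, 0 ≤ R(p) ∧ ∀ g unpinned at Λ_o, 0 ≤ T_g(p)` is carried through the
pin induction on the number of unpinned edges.  Its `T`-part at an edge `g` of `Λ_o` is settled by
`r21_T_nonneg_of_single_edge` (P2-G21-SINGLEEDGE.md §3) when `g` is the ONLY unpinned edge at
`Λ_o`, by `r21_T_internal_edge` (`T_g = 2 R(p[g↦0])`) when both ends of `g` lie in `Λ_o`, and
otherwise by expanding `T_g` along a second unpinned edge `f` of `Λ_o`:

  `T_g(p) = (1 − w_f)² T_g(p[f↦0]) + w_f (1 − w_f) M_{fg}(p) + w_f² T_g(p[f↦1])`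

(`r21_T_eq_bernstein_two`), whose ends are nonnegative by the induction hypothesis (`g` stays at
`Λ_o` under either pin of `f`); the `R`-part follows from `r21_slack_eq_bernstein`.  So the ONE
missing lemma of the (PM⁺) line is the two-edge mixed coefficient

  **(M2-o)  `0 ≤ M_{fg}(p) = T(p[f↦0,g↦0], p[f↦1,g↦1]) + T(p[f↦1,g↦0], p[f↦0,g↦1])`**

for two unpinned edges `f ≠ g` at `Λ_o`, given `0 ≤ T_g` at both pins of `f` (census 0 / 66,422
pairs, P2-G21-SINGLEEDGE.md §4): `r21_of_m2o` — **(R2-1) for every weight vector and every mark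
assignment ⟸ (M2-o)**.

* `r21_T_bernstein_algebra`, `r21_T_eq_bernstein_two` — the two-edge Bernstein form of `T_g`;
* `r21_T_internal_edge` — an edge inside `Λ_o` has `T_g = 2 R(p[g↦0])`;
* `pinned_update_zero_eq`, `pinned_le_update_one` — `Λ_o` under a closed / open pin;
* `pin_strong_induction` — strong induction on the number of unpinned edges;
* `r21_of_m2o` — **the frame**.
-/

namespace Summit.Ventures.PercRepro2

section NestedFrame

variable {V : Type*} {E : Type*} [Fintype E] [DecidableEq E]
  {R : Type*} [CommRing R] [LinearOrder R] [IsStrictOrderedRing R]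


omit [LinearOrder R] [IsStrictOrderedRing R] in
/-- The two-edge Bernstein identity for the symmetric mixed term: with the `g`-worlds affine in `w`
(`W·0 = (1 − w)·W00 + w·W10`, `W·1 = (1 − w)·W01 + w·W11`), `T_g` is a quadratic in `w` whose middle
coefficient is `T(W00, W11) + T(W10, W01)`. -/
lemma r21_T_bernstein_algebra (w a1 a2 a3 a4 a5 a6 a7 a8 a9 b1 b2 b3 b4 b5 b6 b7 b8 b9 c1 c2 c3 c4 c5 c6 c7 c8 c9 d1 d2 d3 d4 d5 d6 d7 d8 d9 : R) :
    (((1 - w) * a1 + w * c1) + ((1 - w) * b1 + w * d1) + ((1 - w) * a2 + w * c2) + ((1 - w) * b2 + w * d2) + ((1 - w) * a3 + w * c3) * ((1 - w) * b4 + w * d4) + ((1 - w) * b3 + w * d3) * ((1 - w) * a4 + w * c4) - (((1 - w) * a5 + w * c5) * ((1 - w) * b6 + w * d6) + ((1 - w) * b5 + w * d5) * ((1 - w) * a6 + w * c6) + ((1 - w) * a7 + w * c7) * ((1 - w) * b8 + w * d8) + ((1 - w) * b7 + w * d7) * ((1 - w) * a8 + w * c8) + ((1 - w) * a9 + w * c9)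 * ((1 - w) * b8 + w * d8) + ((1 - w) * b9 + w * d9) * ((1 - w) * a8 + w * c8))) =
      (1 - w) ^ 2 * (a1 + b1 + a2 + b2 + a3 * b4 + b3 * a4 - (a5 * b6 + b5 * a6 + a7 * b8 + b7 * a8 + a9 * b8 + b9 * a8)) +
        w * (1 - w) * ((a1 + d1 + a2 + d2 + a3 * d4 + d3 * a4 - (a5 * d6 + d5 * a6 + a7 * d8 + d7 * a8 + a9 * d8 + d9 * a8)) + (c1 + b1 + c2 + b2 + c3 * b4 + b3 * c4 - (c5 * b6 + b5 * c6 + c7 * b8 + b7 * c8 + c9 * b8 + b9 * c8))) +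
        w ^ 2 * (c1 + d1 + c2 + d2 + c3 * d4 + d3 * c4 - (c5 * d6 + d5 * c6 + c7 * d8 + d7 * c8 + c9 * d8 + d9 * c8)) := by
  ring

omit [LinearOrder R] [IsStrictOrderedRing R] in
/-- **The Bernstein form of `T_g` along a second edge `f ≠ g`**: the middle coefficient is the two-edge
mixed term `M_{fg}(p) = T(p[f↦0,g↦0], p[f↦1,g↦1]) + T(p[f↦1,g↦0], p[f↦0,g↦1])`. -/
lemma r21_T_eq_bernstein_two (p : E → R) (ends : E → Sym2 V) (s y o u : V) (f g : E) (hfg : f ≠ g) :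
    (prob (Function.update p g 0) (connEvent ends s u ∩ clusterInEvent ends s {W : Set V | o ∈ W} ∩ (connEvent ends s y)ᶜ) + prob (Function.update p g 1) (connEvent ends s u ∩ clusterInEvent ends s {W : Set V | o ∈ W} ∩ (connEvent ends s y)ᶜ) + prob (Function.update p g 0) (connEvent ends s u ∩ connEvent ends y o ∩ (connEvent ends s y)ᶜ) + prob (Function.update p g 1) (connEvent ends s u ∩ connEvent ends y o ∩ (connEvent ends s y)ᶜ) + prob (Function.update p g 0) ((connEvent ends s y)ᶜ) * prob (Function.update p g 1) (connEvent ends s u ∩ clusterInEvent ends s {W : Set V | o ∈ W}) + prob (Function.update p g 1) ((connEvent ends s y)ᶜ) * prob (Function.update p g 0) (connEvent ends s u ∩ clusterInEvent ends s {W : Set V | o ∈ W}) - (prob (Function.update p g 0) (connEvent ends s u ∩ (connEvent ends s y)ᶜ) * prob (Function.update p g 1) (clusterInEvent ends s {W : Set V | o ∈ W}) + prob (Function.update p g 1) (connEvent ends s u ∩ (connEvent ends s y)ᶜ) * prob (Function.update p g 0) (clusterInEvent ends s {W : Set V | o ∈ W}) + prob (Function.update p g 0) (clusterInEvent ends s {W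 : Set V | o ∈ W} ∩ (connEvent ends s y)ᶜ) * prob (Function.update p g 1) (connEvent ends s u) + prob (Function.update p g 1) (clusterInEvent ends s {W : Set V | o ∈ W} ∩ (connEvent ends s y)ᶜ) * prob (Function.update p g 0) (connEvent ends s u) + prob (Function.update p g 0) (connEvent ends y o ∩ (connEvent ends s y)ᶜ) * prob (Function.update p g 1) (connEvent ends s u) + prob (Function.update p g 1) (connEvent ends y o ∩ (connEvent ends s y)ᶜ) * prob (Function.update p g 0) (connEvent ends s u))) =
      (1 - p f) ^ 2 * (prob (Function.update (Function.update p f 0) g 0) (connEvent ends s u ∩ clusterInEvent ends s {W : Set V | o ∈ W} ∩ (connEvent ends s y)ᶜ) + prob (Function.update (Function.update p f 0) g 1) (connEvent ends s u ∩ clusterInEvent ends s {W : Set V | o ∈ W} ∩ (connEvent ends s y)ᶜ) + prob (Function.update (Function.update p f 0) g 0) (connEvent ends s u ∩ connEvent ends y o ∩ (connEvent ends s y)ᶜ) + prob (Function.update (Function.update p f 0) g 1) (connEvent ends s u ∩ connEvent ends y o ∩ (connEvent ends s y)ᶜ) + prob (Function.update (Function.update p f 0) g 0) ((connEvent ends s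 y)ᶜ) * prob (Function.update (Function.update p f 0) g 1) (connEvent ends s u ∩ clusterInEvent ends s {W : Set V | o ∈ W}) + prob (Function.update (Function.update p f 0) g 1) ((connEvent ends s y)ᶜ) * prob (Function.update (Function.update p f 0) g 0) (connEvent ends s u ∩ clusterInEvent ends s {W : Set V | o ∈ W}) - (prob (Function.update (Function.update p f 0) g 0) (connEvent ends s u ∩ (connEvent ends s y)ᶜ) * prob (Function.update (Function.update p f 0) g 1) (clusterInEvent ends s {W : Set V | o ∈ W}) + prob (Function.update (Function.update p f 0) g 1) (connEvent ends s u ∩ (connEvent ends s y)ᶜ) * prob (Function.update (Function.update p f 0) g 0) (clusterInEvent ends s {W : Set V | o ∈ W}) + prob (Function.update (Function.update p f 0) g 0) (clusterInEvent ends s {W : Set V | o ∈ W} ∩ (connEvent ends s y)ᶜ) * prob (Function.update (Function.update p f 0) g 1) (connEvent ends s u) + prob (Function.update (Function.update p f 0) g 1) (clusterInEvent ends s {W : Set V | o ∈ W} ∩ (connEvent ends s y)ᶜ) * prob (Function.update (Function.update p f 0) g 0) (connEvent ends s u) + prob (Function.update (Function.update p f 0) g 0) (connEvent ends y o ∩ (connEvent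 ends s y)ᶜ) * prob (Function.update (Function.update p f 0) g 1) (connEvent ends s u) + prob (Function.update (Function.update p f 0) g 1) (connEvent ends y o ∩ (connEvent ends s y)ᶜ) * prob (Function.update (Function.update p f 0) g 0) (connEvent ends s u))) +
        p f * (1 - p f) * ((prob (Function.update (Function.update p f 0) g 0) (connEvent ends s u ∩ clusterInEvent ends s {W : Set V | o ∈ W} ∩ (connEvent ends s y)ᶜ) + prob (Function.update (Function.update p f 1) g 1) (connEvent ends s u ∩ clusterInEvent ends s {W : Set V | o ∈ W} ∩ (connEvent ends s y)ᶜ) + prob (Function.update (Function.update p f 0) g 0) (connEvent ends s u ∩ connEvent ends y o ∩ (connEvent ends s y)ᶜ) + prob (Function.update (Function.update p f 1) g 1) (connEvent ends s u ∩ connEvent ends y o ∩ (connEvent ends s y)ᶜ) + prob (Function.update (Function.update p f 0) g 0) ((connEvent ends s y)ᶜ) * prob (Function.update (Function.update p f 1) g 1) (connEvent ends s u ∩ clusterInEvent ends s {W : Set V | o ∈ W}) + prob (Function.update (Function.update p f 1) g 1) ((connEvent ends s y)ᶜ) * prob (Function.update (Function.update p f 0) g 0) (connEvent ends s u ∩ clusterInEvent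 ends s {W : Set V | o ∈ W}) - (prob (Function.update (Function.update p f 0) g 0) (connEvent ends s u ∩ (connEvent ends s y)ᶜ) * prob (Function.update (Function.update p f 1) g 1) (clusterInEvent ends s {W : Set V | o ∈ W}) + prob (Function.update (Function.update p f 1) g 1) (connEvent ends s u ∩ (connEvent ends s y)ᶜ) * prob (Function.update (Function.update p f 0) g 0) (clusterInEvent ends s {W : Set V | o ∈ W}) + prob (Function.update (Function.update p f 0) g 0) (clusterInEvent ends s {W : Set V | o ∈ W} ∩ (connEvent ends s y)ᶜ) * prob (Function.update (Function.update p f 1) g 1) (connEvent ends s u) + prob (Function.update (Function.update p f 1) g 1) (clusterInEvent ends s {W : Set V | o ∈ W} ∩ (connEvent ends s y)ᶜ) * prob (Function.update (Function.update p f 0) g 0) (connEvent ends s u) + prob (Function.update (Function.update p f 0) g 0) (connEvent ends y o ∩ (connEvent ends s y)ᶜ) * prob (Function.update (Function.update p f 1) g 1) (connEvent ends s u) + prob (Function.update (Function.update p f 1) g 1) (connEvent ends y o ∩ (connEvent ends s y)ᶜ) * prob (Function.update (Function.update p f 0) g 0) (connEvent ends s u))) + (prob (Function.update (Function.update p f 1)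 g 0) (connEvent ends s u ∩ clusterInEvent ends s {W : Set V | o ∈ W} ∩ (connEvent ends s y)ᶜ) + prob (Function.update (Function.update p f 0) g 1) (connEvent ends s u ∩ clusterInEvent ends s {W : Set V | o ∈ W} ∩ (connEvent ends s y)ᶜ) + prob (Function.update (Function.update p f 1) g 0) (connEvent ends s u ∩ connEvent ends y o ∩ (connEvent ends s y)ᶜ) + prob (Function.update (Function.update p f 0) g 1) (connEvent ends s u ∩ connEvent ends y o ∩ (connEvent ends s y)ᶜ) + prob (Function.update (Function.update p f 1) g 0) ((connEvent ends s y)ᶜ) * prob (Function.update (Function.update p f 0) g 1) (connEvent ends s u ∩ clusterInEvent ends s {W : Set V | o ∈ W}) + prob (Function.update (Function.update p f 0) g 1) ((connEvent ends s y)ᶜ) * prob (Function.update (Function.update p f 1) g 0) (connEvent ends s u ∩ clusterInEvent ends s {W : Set V | o ∈ W}) - (prob (Function.update (Function.update p f 1) g 0) (connEvent ends s u ∩ (connEvent ends s y)ᶜ) * prob (Function.update (Function.update p f 0) g 1) (clusterInEvent ends s {W : Set V | o ∈ W}) + prob (Function.update (Function.update p f 0) g 1) (connEvent ends s u ∩ (connEvent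 ends s y)ᶜ) * prob (Function.update (Function.update p f 1) g 0) (clusterInEvent ends s {W : Set V | o ∈ W}) + prob (Function.update (Function.update p f 1) g 0) (clusterInEvent ends s {W : Set V | o ∈ W} ∩ (connEvent ends s y)ᶜ) * prob (Function.update (Function.update p f 0) g 1) (connEvent ends s u) + prob (Function.update (Function.update p f 0) g 1) (clusterInEvent ends s {W : Set V | o ∈ W} ∩ (connEvent ends s y)ᶜ) * prob (Function.update (Function.update p f 1) g 0) (connEvent ends s u) + prob (Function.update (Function.update p f 1) g 0) (connEvent ends y o ∩ (connEvent ends s y)ᶜ) * prob (Function.update (Function.update p f 0) g 1) (connEvent ends s u) + prob (Function.update (Function.update p f 0) g 1) (connEvent ends y o ∩ (connEvent ends s y)ᶜ) * prob (Function.update (Function.update p f 1) g 0) (connEvent ends s u)))) +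
        p f ^ 2 * (prob (Function.update (Function.update p f 1) g 0) (connEvent ends s u ∩ clusterInEvent ends s {W : Set V | o ∈ W} ∩ (connEvent ends s y)ᶜ) + prob (Function.update (Function.update p f 1) g 1) (connEvent ends s u ∩ clusterInEvent ends s {W : Set V | o ∈ W} ∩ (connEvent ends s y)ᶜ) + prob (Function.update (Function.update p f 1) g 0) (connEvent ends s u ∩ connEvent ends y o ∩ (connEvent ends s y)ᶜ) + prob (Function.update (Function.update p f 1) g 1) (connEvent ends s u ∩ connEvent ends y o ∩ (connEvent ends s y)ᶜ) + prob (Function.update (Function.update p f 1) g 0) ((connEvent ends s y)ᶜ) * prob (Function.update (Function.update p f 1) g 1) (connEvent ends s u ∩ clusterInEvent ends s {W : Set V | o ∈ W}) + prob (Function.update (Function.update p f 1) g 1) ((connEvent ends s y)ᶜ) * prob (Function.update (Function.update p f 1) g 0) (connEvent ends s u ∩ clusterInEvent ends s {W : Set V | o ∈ W}) - (prob (Function.update (Function.update p f 1) g 0) (connEvent ends s u ∩ (connEvent ends s y)ᶜ) * prob (Function.update (Function.update p f 1) g 1) (clusterInEvent ends s {W : Set V | o ∈ W}) + prob (Function.update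 (Function.update p f 1) g 1) (connEvent ends s u ∩ (connEvent ends s y)ᶜ) * prob (Function.update (Function.update p f 1) g 0) (clusterInEvent ends s {W : Set V | o ∈ W}) + prob (Function.update (Function.update p f 1) g 0) (clusterInEvent ends s {W : Set V | o ∈ W} ∩ (connEvent ends s y)ᶜ) * prob (Function.update (Function.update p f 1) g 1) (connEvent ends s u) + prob (Function.update (Function.update p f 1) g 1) (clusterInEvent ends s {W : Set V | o ∈ W} ∩ (connEvent ends s y)ᶜ) * prob (Function.update (Function.update p f 1) g 0) (connEvent ends s u) + prob (Function.update (Function.update p f 1) g 0) (connEvent ends y o ∩ (connEvent ends s y)ᶜ) * prob (Function.update (Function.update p f 1) g 1) (connEvent ends s u) + prob (Function.update (Function.update p f 1) g 1) (connEvent ends y o ∩ (connEvent ends s y)ᶜ) * prob (Function.update (Function.update p f 1) g 0) (connEvent ends s u))) := by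
  have hw0 : Function.update p g 0 f = p f := Function.update_of_ne hfg _ _
  have hw1 : Function.update p g 1 f = p f := Function.update_of_ne hfg _ _
  have hc00 : Function.update (Function.update p g 0) f 0 = Function.update (Function.update p f 0) g 0 := Function.update_comm hfg.symm _ _ _
  have hc01 : Function.update (Function.update p g 1) f 0 = Function.update (Function.update p f 0) g 1 := Function.update_comm hfg.symm _ _ _
  have hc10 : Function.update (Function.update p g 0) f 1 = Function.update (Function.update p f 1) g 0 := Function.update_comm hfg.symm _ _ _
  have hc11 : Function.update (Function.update p g 1) f 1 = Function.update (Function.update p f 1) g 1 := Function.update_comm hfg.symm _ _ _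
  simp only [prob_eq_pin (Function.update p g 0) _ f, prob_eq_pin (Function.update p g 1) _ f, hw0, hw1, hc00, hc01, hc10, hc11]
  have e := r21_T_bernstein_algebra (p f)
    (prob (Function.update (Function.update p f 0) g 0) (connEvent ends s u ∩ clusterInEvent ends s {W : Set V | o ∈ W} ∩ (connEvent ends s y)ᶜ))
    (prob (Function.update (Function.update p f 0) g 0) (connEvent ends s u ∩ connEvent ends y o ∩ (connEvent ends s y)ᶜ))
    (prob (Function.update (Function.update p f 0) g 0) ((connEvent ends s y)ᶜ))
    (prob (Function.update (Function.update p f 0) g 0) (connEvent ends s u ∩ clusterInEvent ends s {W : Set V | o ∈ W}))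
    (prob (Function.update (Function.update p f 0) g 0) (connEvent ends s u ∩ (connEvent ends s y)ᶜ))
    (prob (Function.update (Function.update p f 0) g 0) (clusterInEvent ends s {W : Set V | o ∈ W}))
    (prob (Function.update (Function.update p f 0) g 0) (clusterInEvent ends s {W : Set V | o ∈ W} ∩ (connEvent ends s y)ᶜ))
    (prob (Function.update (Function.update p f 0) g 0) (connEvent ends s u))
    (prob (Function.update (Function.update p f 0) g 0) (connEvent ends y o ∩ (connEvent ends s y)ᶜ))
    (prob (Function.update (Function.update p f 0) g 1) (connEvent ends s u ∩ clusterInEvent ends s {W : Set V | o ∈ W} ∩ (connEvent ends s y)ᶜ))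
    (prob (Function.update (Function.update p f 0) g 1) (connEvent ends s u ∩ connEvent ends y o ∩ (connEvent ends s y)ᶜ))
    (prob (Function.update (Function.update p f 0) g 1) ((connEvent ends s y)ᶜ))
    (prob (Function.update (Function.update p f 0) g 1) (connEvent ends s u ∩ clusterInEvent ends s {W : Set V | o ∈ W}))
    (prob (Function.update (Function.update p f 0) g 1) (connEvent ends s u ∩ (connEvent ends s y)ᶜ))
    (prob (Function.update (Function.update p f 0) g 1) (clusterInEvent ends s {W : Set V | o ∈ W}))
    (prob (Function.update (Function.update p f 0) g 1) (clusterInEvent ends s {W : Set V | o ∈ W} ∩ (connEvent ends s y)ᶜ))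
    (prob (Function.update (Function.update p f 0) g 1) (connEvent ends s u))
    (prob (Function.update (Function.update p f 0) g 1) (connEvent ends y o ∩ (connEvent ends s y)ᶜ))
    (prob (Function.update (Function.update p f 1) g 0) (connEvent ends s u ∩ clusterInEvent ends s {W : Set V | o ∈ W} ∩ (connEvent ends s y)ᶜ))
    (prob (Function.update (Function.update p f 1) g 0) (connEvent ends s u ∩ connEvent ends y o ∩ (connEvent ends s y)ᶜ))
    (prob (Function.update (Function.update p f 1) g 0) ((connEvent ends s y)ᶜ))
    (prob (Function.update (Function.update p f 1) g 0) (connEvent ends s u ∩ clusterInEvent ends s {W : Set V | o ∈ W}))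
    (prob (Function.update (Function.update p f 1) g 0) (connEvent ends s u ∩ (connEvent ends s y)ᶜ))
    (prob (Function.update (Function.update p f 1) g 0) (clusterInEvent ends s {W : Set V | o ∈ W}))
    (prob (Function.update (Function.update p f 1) g 0) (clusterInEvent ends s {W : Set V | o ∈ W} ∩ (connEvent ends s y)ᶜ))
    (prob (Function.update (Function.update p f 1) g 0) (connEvent ends s u))
    (prob (Function.update (Function.update p f 1) g 0) (connEvent ends y o ∩ (connEvent ends s y)ᶜ))
    (prob (Function.update (Function.update p f 1) g 1) (connEvent ends s u ∩ clusterInEvent ends s {W : Set V | o ∈ W} ∩ (connEvent ends s y)ᶜ))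
    (prob (Function.update (Function.update p f 1) g 1) (connEvent ends s u ∩ connEvent ends y o ∩ (connEvent ends s y)ᶜ))
    (prob (Function.update (Function.update p f 1) g 1) ((connEvent ends s y)ᶜ))
    (prob (Function.update (Function.update p f 1) g 1) (connEvent ends s u ∩ clusterInEvent ends s {W : Set V | o ∈ W}))
    (prob (Function.update (Function.update p f 1) g 1) (connEvent ends s u ∩ (connEvent ends s y)ᶜ))
    (prob (Function.update (Function.update p f 1) g 1) (clusterInEvent ends s {W : Set V | o ∈ W}))
    (prob (Function.update (Function.update p f 1) g 1) (clusterInEvent ends s {W : Set V | o ∈ W} ∩ (connEvent ends s y)ᶜ))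
    (prob (Function.update (Function.update p f 1) g 1) (connEvent ends s u))
    (prob (Function.update (Function.update p f 1) g 1) (connEvent ends y o ∩ (connEvent ends s y)ᶜ))
  linear_combination e
omit [IsStrictOrderedRing R] in
/-- **An edge inside the explored `o`-component changes nothing**: with `f = {x, z}`, `x, z ∈ Λ_o`, every
open-world mass equals the closed-world one. -/
lemma r21_internal_transfer (p : E → R) (ends : E → Sym2 V) (s y o u x z : V) (f : E)
    (hf : ends f = s(x, z)) (hx : Conn ends (fun e => decide (p e = 1)) o x) (hz : Conn ends (fun e => decide (p e = 1)) o z) (hpf : p f ≠ 1) :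
      prob (Function.update p f 1) (connEvent ends s u ∩ clusterInEvent ends s {W : Set V | o ∈ W} ∩ (connEvent ends s y)ᶜ) = prob (Function.update p f 0) (connEvent ends s u ∩ clusterInEvent ends s {W : Set V | o ∈ W} ∩ (connEvent ends s y)ᶜ) ∧
      prob (Function.update p f 1) (connEvent ends s u ∩ connEvent ends y o ∩ (connEvent ends s y)ᶜ) = prob (Function.update p f 0) (connEvent ends s u ∩ connEvent ends y o ∩ (connEvent ends s y)ᶜ) ∧
      prob (Function.update p f 1) ((connEvent ends s y)ᶜ) = prob (Function.update p f 0) ((connEvent ends s y)ᶜ) ∧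
      prob (Function.update p f 1) (connEvent ends s u ∩ clusterInEvent ends s {W : Set V | o ∈ W}) = prob (Function.update p f 0) (connEvent ends s u ∩ clusterInEvent ends s {W : Set V | o ∈ W}) ∧
      prob (Function.update p f 1) (connEvent ends s u ∩ (connEvent ends s y)ᶜ) = prob (Function.update p f 0) (connEvent ends s u ∩ (connEvent ends s y)ᶜ) ∧
      prob (Function.update p f 1) (clusterInEvent ends s {W : Set V | o ∈ W}) = prob (Function.update p f 0) (clusterInEvent ends s {W : Set V | o ∈ W}) ∧
      prob (Function.update p f 1) (clusterInEvent ends s {W : Set V | o ∈ W} ∩ (connEvent ends s y)ᶜ) = prob (Function.update p f 0) (clusterInEvent ends s {W : Set V | o ∈ W} ∩ (connEvent ends s y)ᶜ) ∧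
      prob (Function.update p f 1) (connEvent ends s u) = prob (Function.update p f 0) (connEvent ends s u) ∧
      prob (Function.update p f 1) (connEvent ends y o ∩ (connEvent ends s y)ᶜ) = prob (Function.update p f 0) (connEvent ends y o ∩ (connEvent ends s y)ᶜ) := by
  have key : ∀ ω : Config E, (∀ e, e ≠ f → p e = 1 → ω e = true) → ∀ a b,
      (Conn ends (Function.update ω f true) a b ↔ Conn ends (Function.update ω f false) a b) := by
    intro ω h1 a b
    have hxo := conn_x_iff_o (ends := ends) hx hpf h1
    have hzo := conn_x_iff_o (ends := ends) hz hpf h1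
    have hoz : Conn ends (Function.update ω f false) o z := conn_symm ((hzo o).2 (conn_refl _ _ _))
    have hxz : Conn ends (Function.update ω f false) x z := (hxo z).2 hoz
    rw [conn_update_true_iff_or hf]
    constructor
    · rintro (h | ⟨h1, h2⟩ | ⟨h1, h2⟩)
      · exact h
      · exact conn_trans h1 (conn_trans hxz h2)
      · exact conn_trans h1 (conn_trans (conn_symm hxz) h2)
    · exact fun h => Or.inl h
  refine ⟨?_, ?_, ?_, ?_, ?_, ?_, ?_, ?_, ?_⟩ <;>
  · refine prob_update_one_eq_prob_update_zero_of_respects p f fun ω _ h1 => ?_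
    simp only [Set.mem_inter_iff, mem_connEvent, mem_clusterInEvent, Set.mem_setOf_eq, mem_cluster,
      Set.mem_compl_iff, key ω h1]

omit [IsStrictOrderedRing R] in
/-- **An internal edge of `Λ_o` has `T_f = 2·R(p[f↦0])`.** -/
lemma r21_T_internal_edge (p : E → R) (ends : E → Sym2 V) (s y o u x z : V) (f : E)
    (hf : ends f = s(x, z)) (hx : Conn ends (fun e => decide (p e = 1)) o x) (hz : Conn ends (fun e => decide (p e = 1)) o z) (hpf : p f ≠ 1) :
    (prob (Function.update p f 0) (connEvent ends s u ∩ clusterInEvent ends s {W : Set V | o ∈ W} ∩ (connEvent ends s y)ᶜ) + prob (Function.update p f 1) (connEvent ends s u ∩ clusterInEvent ends s {W : Set V | o ∈ W} ∩ (connEvent ends s y)ᶜ) + prob (Function.update p f 0) (connEvent ends s u ∩ connEvent ends y o ∩ (connEvent ends s y)ᶜ) + prob (Function.update p f 1) (connEvent ends s u ∩ connEvent ends y o ∩ (connEvent ends s y)ᶜ) + prob (Function.update p f 0) ((connEvent ends s y)ᶜ) * prob (Function.update p f 1) (connEvent ends s u ∩ clusterInEvent ends s {W : Set V | o ∈ W})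 + prob (Function.update p f 1) ((connEvent ends s y)ᶜ) * prob (Function.update p f 0) (connEvent ends s u ∩ clusterInEvent ends s {W : Set V | o ∈ W}) - (prob (Function.update p f 0) (connEvent ends s u ∩ (connEvent ends s y)ᶜ) * prob (Function.update p f 1) (clusterInEvent ends s {W : Set V | o ∈ W}) + prob (Function.update p f 1) (connEvent ends s u ∩ (connEvent ends s y)ᶜ) * prob (Function.update p f 0) (clusterInEvent ends s {W : Set V | o ∈ W}) + prob (Function.update p f 0) (clusterInEvent ends s {W : Set V | o ∈ W} ∩ (connEvent ends s y)ᶜ) * prob (Function.update p f 1) (connEvent ends s u) + prob (Function.update p f 1) (clusterInEvent ends s {W : Set V | o ∈ W} ∩ (connEvent ends s y)ᶜ) * prob (Function.update p f 0) (connEvent ends s u) + prob (Function.update p f 0) (connEvent ends y o ∩ (connEvent ends s y)ᶜ) * prob (Function.update p f 1) (connEvent ends s u) + prob (Function.update p f 1) (connEvent ends y o ∩ (connEvent ends s y)ᶜ) * prob (Function.update p f 0) (connEvent ends s u))) = 2 * (prob (Function.update p f 0) (connEvent ends s u ∩ clusterInEvent ends s {W : Set V | o ∈ W} ∩ (connEvent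 ends s y)ᶜ) + prob (Function.update p f 0) (connEvent ends s u ∩ connEvent ends y o ∩ (connEvent ends s y)ᶜ) + prob (Function.update p f 0) ((connEvent ends s y)ᶜ) * prob (Function.update p f 0) (connEvent ends s u ∩ clusterInEvent ends s {W : Set V | o ∈ W}) - (prob (Function.update p f 0) (connEvent ends s u ∩ (connEvent ends s y)ᶜ) * prob (Function.update p f 0) (clusterInEvent ends s {W : Set V | o ∈ W}) + prob (Function.update p f 0) (clusterInEvent ends s {W : Set V | o ∈ W} ∩ (connEvent ends s y)ᶜ) * prob (Function.update p f 0) (connEvent ends s u) + prob (Function.update p f 0) (connEvent ends y o ∩ (connEvent ends s y)ᶜ) * prob (Function.update p f 0) (connEvent ends s u))) := by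
  obtain ⟨t1, t2, t3, t4, t5, t6, t7, t8, t9⟩ := r21_internal_transfer p ends s y o u x z f hf hx hz hpf
  rw [t1, t2, t3, t4, t5, t6, t7, t8, t9]
  ring

omit [Fintype E] in
/-- Pinning an unpinned edge closed does not change the pinned-open configuration. -/
lemma pinned_update_zero_eq (p : E → R) (f : E) (hpf : p f ≠ 1) :
    (fun e => decide (Function.update p f 0 e = 1)) = fun e => decide (p e = 1) := by
  funext e
  by_cases hef : e = f
  · subst hef
    have h01 : (0 : R) ≠ 1 := zero_ne_one
    simp [hpf, h01]
  · simp [Function.update_of_ne hef]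

omit [Fintype E] [IsStrictOrderedRing R] in
/-- Pinning an edge open enlarges the pinned-open configuration. -/
lemma pinned_le_update_one (p : E → R) (f : E) :
    (fun e => decide (p e = 1)) ≤ fun e => decide (Function.update p f 1 e = 1) := by
  intro e
  by_cases hef : e = f
  · subst hef; simp
  · simp [Function.update_of_ne hef]

omit [DecidableEq E] [IsStrictOrderedRing R] in
/-- **Strong induction on the number of unpinned edges**: to prove `Φ p` one may assume `Φ` for every
admissible `p'` with fewer unpinned edges. -/
theorem pin_strong_induction (Φ : (E → R) → Prop)
    (hstep : ∀ p : E → R, IsProbVec p →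
      (∀ p' : E → R, IsProbVec p' →
        (Finset.univ.filter fun e => p' e ≠ 0 ∧ p' e ≠ 1).card <
          (Finset.univ.filter fun e => p e ≠ 0 ∧ p e ≠ 1).card → Φ p') → Φ p) :
    ∀ p : E → R, IsProbVec p → Φ p := by
  have key : ∀ n : ℕ, ∀ p : E → R, IsProbVec p →
      (Finset.univ.filter fun e => p e ≠ 0 ∧ p e ≠ 1).card = n → Φ p := by
    intro n
    induction n using Nat.strong_induction_on with
    | _ n ih =>
      intro p hp hcard
      refine hstep p hp fun p' hp' hlt => ?_
      rw [hcard] at hlt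
      exact ih _ hlt p' hp' rfl
  intro p hp
  exact key _ p hp rfl

omit [IsStrictOrderedRing R] in
/-- Pinning an unpinned edge lowers the number of unpinned edges. -/
lemma card_unpinned_update_lt (p : E → R) (f : E) (hf0 : p f ≠ 0) (hf1 : p f ≠ 1) (c : R)
    (hc : c = 0 ∨ c = 1) :
    (Finset.univ.filter fun e => Function.update p f c e ≠ 0 ∧ Function.update p f c e ≠ 1).card <
      (Finset.univ.filter fun e => p e ≠ 0 ∧ p e ≠ 1).card := by
  have hsub : (Finset.univ.filter fun e => Function.update p f c e ≠ 0 ∧ Function.update p f c e ≠ 1) =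
      (Finset.univ.filter fun e => p e ≠ 0 ∧ p e ≠ 1).erase f := by
    ext e
    simp only [Finset.mem_filter, Finset.mem_univ, true_and, Finset.mem_erase]
    by_cases hef : e = f
    · subst hef
      simp only [Function.update_self, ne_eq, not_true_eq_false, false_and, iff_false, not_and]
      intro h0 h1
      rcases hc with rfl | rfl
      · exact h0 rfl
      · exact h1 rfl
    · simp [hef]
  rw [hsub]
  exact Finset.card_erase_lt_of_mem (by simp [hf0, hf1])

/-- **The frame: (R2-1) for every weight vector and every mark assignment ⟸ (M2-o).** -/
theorem r21_of_m2o (ends : E → Sym2 V)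
    (hM : ∀ p : E → R, IsProbVec p → ∀ s y o u : V, ∀ f g : E, f ≠ g →
      (∃ v ∈ ends f, Conn ends (fun e => decide (p e = 1)) o v) → p f ≠ 0 → p f ≠ 1 →
      (∃ v ∈ ends g, Conn ends (fun e => decide (p e = 1)) o v) → p g ≠ 0 → p g ≠ 1 →
      0 ≤ (prob (Function.update (Function.update p f 0) g 0) (connEvent ends s u ∩ clusterInEvent ends s {W : Set V | o ∈ W} ∩ (connEvent ends s y)ᶜ) + prob (Function.update (Function.update p f 0) g 1) (connEvent ends s u ∩ clusterInEvent ends s {W : Set V | o ∈ W} ∩ (connEvent ends s y)ᶜ) + prob (Function.update (Function.update p f 0) g 0) (connEvent ends s u ∩ connEvent ends y o ∩ (connEvent ends s y)ᶜ) + prob (Function.update (Function.update p f 0) g 1) (connEvent ends s u ∩ connEvent ends y o ∩ (connEvent ends s y)ᶜ) + prob (Function.update (Function.update p f 0) g 0) ((connEvent ends s y)ᶜ) * prob (Function.update (Function.update p f 0) g 1) (connEvent ends s u ∩ clusterInEvent ends s {W : Set V | o ∈ W}) + prob (Function.update (Function.update p f 0) g 1) ((connEvent ends s y)ᶜ) *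 prob (Function.update (Function.update p f 0) g 0) (connEvent ends s u ∩ clusterInEvent ends s {W : Set V | o ∈ W}) - (prob (Function.update (Function.update p f 0) g 0) (connEvent ends s u ∩ (connEvent ends s y)ᶜ) * prob (Function.update (Function.update p f 0) g 1) (clusterInEvent ends s {W : Set V | o ∈ W}) + prob (Function.update (Function.update p f 0) g 1) (connEvent ends s u ∩ (connEvent ends s y)ᶜ) * prob (Function.update (Function.update p f 0) g 0) (clusterInEvent ends s {W : Set V | o ∈ W}) + prob (Function.update (Function.update p f 0) g 0) (clusterInEvent ends s {W : Set V | o ∈ W} ∩ (connEvent ends s y)ᶜ) * prob (Function.update (Function.update p f 0) g 1) (connEvent ends s u) + prob (Function.update (Function.update p f 0) g 1) (clusterInEvent ends s {W : Set V | o ∈ W} ∩ (connEvent ends s y)ᶜ) * prob (Function.update (Function.update p f 0) g 0) (connEvent ends s u) + prob (Function.update (Function.update p f 0) g 0) (connEvent ends y o ∩ (connEvent ends s y)ᶜ) * prob (Function.update (Function.update p f 0) g 1) (connEvent ends s u) + prob (Function.update (Function.update p f 0) g 1) (connEvent ends y o ∩ (connEvent ends s y)ᶜ) * prob (Function.update (Function.update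 p f 0) g 0) (connEvent ends s u))) →
      0 ≤ (prob (Function.update (Function.update p f 1) g 0) (connEvent ends s u ∩ clusterInEvent ends s {W : Set V | o ∈ W} ∩ (connEvent ends s y)ᶜ) + prob (Function.update (Function.update p f 1) g 1) (connEvent ends s u ∩ clusterInEvent ends s {W : Set V | o ∈ W} ∩ (connEvent ends s y)ᶜ) + prob (Function.update (Function.update p f 1) g 0) (connEvent ends s u ∩ connEvent ends y o ∩ (connEvent ends s y)ᶜ) + prob (Function.update (Function.update p f 1) g 1) (connEvent ends s u ∩ connEvent ends y o ∩ (connEvent ends s y)ᶜ) + prob (Function.update (Function.update p f 1) g 0) ((connEvent ends s y)ᶜ) * prob (Function.update (Function.update p f 1) g 1) (connEvent ends s u ∩ clusterInEvent ends s {W : Set V | o ∈ W}) + prob (Function.update (Function.update p f 1) g 1) ((connEvent ends s y)ᶜ) * prob (Function.update (Function.update p f 1) g 0) (connEvent ends s u ∩ clusterInEvent ends s {W : Set V | o ∈ W}) - (prob (Function.update (Function.update p f 1) g 0) (connEvent ends s u ∩ (connEvent ends s y)ᶜ) * prob (Function.update (Function.update p f 1) g 1) (clusterInEvent ends s {W :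 Set V | o ∈ W}) + prob (Function.update (Function.update p f 1) g 1) (connEvent ends s u ∩ (connEvent ends s y)ᶜ) * prob (Function.update (Function.update p f 1) g 0) (clusterInEvent ends s {W : Set V | o ∈ W}) + prob (Function.update (Function.update p f 1) g 0) (clusterInEvent ends s {W : Set V | o ∈ W} ∩ (connEvent ends s y)ᶜ) * prob (Function.update (Function.update p f 1) g 1) (connEvent ends s u) + prob (Function.update (Function.update p f 1) g 1) (clusterInEvent ends s {W : Set V | o ∈ W} ∩ (connEvent ends s y)ᶜ) * prob (Function.update (Function.update p f 1) g 0) (connEvent ends s u) + prob (Function.update (Function.update p f 1) g 0) (connEvent ends y o ∩ (connEvent ends s y)ᶜ) * prob (Function.update (Function.update p f 1) g 1) (connEvent ends s u) + prob (Function.update (Function.update p f 1) g 1) (connEvent ends y o ∩ (connEvent ends s y)ᶜ) * prob (Function.update (Function.update p f 1) g 0) (connEvent ends s u))) →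
      0 ≤ ((prob (Function.update (Function.update p f 0) g 0) (connEvent ends s u ∩ clusterInEvent ends s {W : Set V | o ∈ W} ∩ (connEvent ends s y)ᶜ) + prob (Function.update (Function.update p f 1) g 1) (connEvent ends s u ∩ clusterInEvent ends s {W : Set V | o ∈ W} ∩ (connEvent ends s y)ᶜ) + prob (Function.update (Function.update p f 0) g 0) (connEvent ends s u ∩ connEvent ends y o ∩ (connEvent ends s y)ᶜ) + prob (Function.update (Function.update p f 1) g 1) (connEvent ends s u ∩ connEvent ends y o ∩ (connEvent ends s y)ᶜ) + prob (Function.update (Function.update p f 0) g 0) ((connEvent ends s y)ᶜ) * prob (Function.update (Function.update p f 1) g 1) (connEvent ends s u ∩ clusterInEvent ends s {W : Set V | o ∈ W}) + prob (Function.update (Function.update p f 1) g 1) ((connEvent ends s y)ᶜ) * prob (Function.update (Function.update p f 0) g 0) (connEvent ends s u ∩ clusterInEvent ends s {W : Set V | o ∈ W}) - (prob (Function.update (Function.update p f 0) g 0) (connEvent ends s u ∩ (connEvent ends s y)ᶜ) * prob (Function.update (Function.update p f 1) g 1) (clusterInEvent ends s {W : Set V | o ∈ W}) + prob (Function.update (Function.update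 p f 1) g 1) (connEvent ends s u ∩ (connEvent ends s y)ᶜ) * prob (Function.update (Function.update p f 0) g 0) (clusterInEvent ends s {W : Set V | o ∈ W}) + prob (Function.update (Function.update p f 0) g 0) (clusterInEvent ends s {W : Set V | o ∈ W} ∩ (connEvent ends s y)ᶜ) * prob (Function.update (Function.update p f 1) g 1) (connEvent ends s u) + prob (Function.update (Function.update p f 1) g 1) (clusterInEvent ends s {W : Set V | o ∈ W} ∩ (connEvent ends s y)ᶜ) * prob (Function.update (Function.update p f 0) g 0) (connEvent ends s u) + prob (Function.update (Function.update p f 0) g 0) (connEvent ends y o ∩ (connEvent ends s y)ᶜ) * prob (Function.update (Function.update p f 1) g 1) (connEvent ends s u) + prob (Function.update (Function.update p f 1) g 1) (connEvent ends y o ∩ (connEvent ends s y)ᶜ) * prob (Function.update (Function.update p f 0) g 0) (connEvent ends s u))) + (prob (Function.update (Function.update p f 1) g 0) (connEvent ends s u ∩ clusterInEvent ends s {W : Set V | o ∈ W} ∩ (connEvent ends s y)ᶜ) + prob (Function.update (Function.update p f 0) g 1) (connEvent ends s u ∩ clusterInEvent ends s {W : Set V | o ∈ W} ∩ (connEvent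 ends s y)ᶜ) + prob (Function.update (Function.update p f 1) g 0) (connEvent ends s u ∩ connEvent ends y o ∩ (connEvent ends s y)ᶜ) + prob (Function.update (Function.update p f 0) g 1) (connEvent ends s u ∩ connEvent ends y o ∩ (connEvent ends s y)ᶜ) + prob (Function.update (Function.update p f 1) g 0) ((connEvent ends s y)ᶜ) * prob (Function.update (Function.update p f 0) g 1) (connEvent ends s u ∩ clusterInEvent ends s {W : Set V | o ∈ W}) + prob (Function.update (Function.update p f 0) g 1) ((connEvent ends s y)ᶜ) * prob (Function.update (Function.update p f 1) g 0) (connEvent ends s u ∩ clusterInEvent ends s {W : Set V | o ∈ W}) - (prob (Function.update (Function.update p f 1) g 0) (connEvent ends s u ∩ (connEvent ends s y)ᶜ) * prob (Function.update (Function.update p f 0) g 1) (clusterInEvent ends s {W : Set V | o ∈ W}) + prob (Function.update (Function.update p f 0) g 1) (connEvent ends s u ∩ (connEvent ends s y)ᶜ) * prob (Function.update (Function.update p f 1) g 0) (clusterInEvent ends s {W : Set V | o ∈ W}) + prob (Function.update (Function.update p f 1) g 0) (clusterInEvent ends s {W : Set V | o ∈ W} ∩ (connEvent ends s y)ᶜ)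 * prob (Function.update (Function.update p f 0) g 1) (connEvent ends s u) + prob (Function.update (Function.update p f 0) g 1) (clusterInEvent ends s {W : Set V | o ∈ W} ∩ (connEvent ends s y)ᶜ) * prob (Function.update (Function.update p f 1) g 0) (connEvent ends s u) + prob (Function.update (Function.update p f 1) g 0) (connEvent ends y o ∩ (connEvent ends s y)ᶜ) * prob (Function.update (Function.update p f 0) g 1) (connEvent ends s u) + prob (Function.update (Function.update p f 0) g 1) (connEvent ends y o ∩ (connEvent ends s y)ᶜ) * prob (Function.update (Function.update p f 1) g 0) (connEvent ends s u))))) :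
    ∀ p : E → R, IsProbVec p → ∀ s y o u : V, 0 ≤ (prob p (connEvent ends s u ∩ clusterInEvent ends s {W : Set V | o ∈ W} ∩ (connEvent ends s y)ᶜ) + prob p (connEvent ends s u ∩ connEvent ends y o ∩ (connEvent ends s y)ᶜ) + prob p ((connEvent ends s y)ᶜ) * prob p (connEvent ends s u ∩ clusterInEvent ends s {W : Set V | o ∈ W}) - (prob p (connEvent ends s u ∩ (connEvent ends s y)ᶜ) * prob p (clusterInEvent ends s {W : Set V | o ∈ W}) + prob p (clusterInEvent ends s {W : Set V | o ∈ W} ∩ (connEvent ends s y)ᶜ) * prob p (connEvent ends s u) + prob p (connEvent ends y o ∩ (connEvent ends s y)ᶜ) * prob p (connEvent ends s u))) := by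
  classical
  suffices hΦ : ∀ p : E → R, IsProbVec p → (fun q : E → R => ∀ s y o u : V, 0 ≤ (prob q (connEvent ends s u ∩ clusterInEvent ends s {W : Set V | o ∈ W} ∩ (connEvent ends s y)ᶜ) + prob q (connEvent ends s u ∩ connEvent ends y o ∩ (connEvent ends s y)ᶜ) + prob q ((connEvent ends s y)ᶜ) * prob q (connEvent ends s u ∩ clusterInEvent ends s {W : Set V | o ∈ W}) - (prob q (connEvent ends s u ∩ (connEvent ends s y)ᶜ) * prob q (clusterInEvent ends s {W : Set V | o ∈ W}) + prob q (clusterInEvent ends s {W : Set V | o ∈ W} ∩ (connEvent ends s y)ᶜ) * prob q (connEvent ends s u) + prob q (connEvent ends y o ∩ (connEvent ends s y)ᶜ) * prob q (connEvent ends s u))) ∧ ∀ g : E, (∃ v ∈ ends g, Conn ends (fun e => decide (q e = 1)) o v) → q g ≠ 0 → q g ≠ 1 → 0 ≤ (prob (Function.update q g 0) (connEvent ends s u ∩ clusterInEvent ends s {W : Set V | o ∈ W} ∩ (connEvent ends s y)ᶜ) + prob (Function.update q g 1) (connEvent ends s u ∩ clusterInEvent ends s {W : Set V | o ∈ W} ∩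 (connEvent ends s y)ᶜ) + prob (Function.update q g 0) (connEvent ends s u ∩ connEvent ends y o ∩ (connEvent ends s y)ᶜ) + prob (Function.update q g 1) (connEvent ends s u ∩ connEvent ends y o ∩ (connEvent ends s y)ᶜ) + prob (Function.update q g 0) ((connEvent ends s y)ᶜ) * prob (Function.update q g 1) (connEvent ends s u ∩ clusterInEvent ends s {W : Set V | o ∈ W}) + prob (Function.update q g 1) ((connEvent ends s y)ᶜ) * prob (Function.update q g 0) (connEvent ends s u ∩ clusterInEvent ends s {W : Set V | o ∈ W}) - (prob (Function.update q g 0) (connEvent ends s u ∩ (connEvent ends s y)ᶜ) * prob (Function.update q g 1) (clusterInEvent ends s {W : Set V | o ∈ W}) + prob (Function.update q g 1) (connEvent ends s u ∩ (connEvent ends s y)ᶜ) * prob (Function.update q g 0) (clusterInEvent ends s {W : Set V | o ∈ W}) + prob (Function.update q g 0) (clusterInEvent ends s {W : Set V | o ∈ W} ∩ (connEvent ends s y)ᶜ) * prob (Function.update q g 1) (connEvent ends s u) + prob (Function.update q g 1) (clusterInEvent ends s {W : Set V | o ∈ W} ∩ (connEvent ends s y)ᶜ) * prob (Function.update q g 0)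 (connEvent ends s u) + prob (Function.update q g 0) (connEvent ends y o ∩ (connEvent ends s y)ᶜ) * prob (Function.update q g 1) (connEvent ends s u) + prob (Function.update q g 1) (connEvent ends y o ∩ (connEvent ends s y)ᶜ) * prob (Function.update q g 0) (connEvent ends s u)))) p by
    intro p hp s y o u
    exact (hΦ p hp s y o u).1
  refine pin_strong_induction _ fun p hp ih => ?_
  intro s y o u
  have hT : ∀ g : E, (∃ v ∈ ends g, Conn ends (fun e => decide (p e = 1)) o v) → p g ≠ 0 → p g ≠ 1 → 0 ≤ (prob (Function.update p g 0) (connEvent ends s u ∩ clusterInEvent ends s {W : Set V | o ∈ W} ∩ (connEvent ends s y)ᶜ) + prob (Function.update p g 1) (connEvent ends s u ∩ clusterInEvent ends s {W : Set V | o ∈ W} ∩ (connEvent ends s y)ᶜ) + prob (Function.update p g 0) (connEvent ends s u ∩ connEvent ends y o ∩ (connEvent ends s y)ᶜ) + prob (Function.update p g 1) (connEvent ends s u ∩ connEvent ends y o ∩ (connEvent ends s y)ᶜ) + prob (Function.update p g 0) ((connEvent ends s y)ᶜ) * prob (Function.update p g 1) (connEvent ends s u ∩ clusterInEvent ends s {W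 : Set V | o ∈ W}) + prob (Function.update p g 1) ((connEvent ends s y)ᶜ) * prob (Function.update p g 0) (connEvent ends s u ∩ clusterInEvent ends s {W : Set V | o ∈ W}) - (prob (Function.update p g 0) (connEvent ends s u ∩ (connEvent ends s y)ᶜ) * prob (Function.update p g 1) (clusterInEvent ends s {W : Set V | o ∈ W}) + prob (Function.update p g 1) (connEvent ends s u ∩ (connEvent ends s y)ᶜ) * prob (Function.update p g 0) (clusterInEvent ends s {W : Set V | o ∈ W}) + prob (Function.update p g 0) (clusterInEvent ends s {W : Set V | o ∈ W} ∩ (connEvent ends s y)ᶜ) * prob (Function.update p g 1) (connEvent ends s u) + prob (Function.update p g 1) (clusterInEvent ends s {W : Set V | o ∈ W} ∩ (connEvent ends s y)ᶜ) * prob (Function.update p g 0) (connEvent ends s u) + prob (Function.update p g 0) (connEvent ends y o ∩ (connEvent ends s y)ᶜ) * prob (Function.update p g 1) (connEvent ends s u) + prob (Function.update p g 1) (connEvent ends y o ∩ (connEvent ends s y)ᶜ) * prob (Function.update p g 0) (connEvent ends s u))) := by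
    intro g hgΛ hg0 hg1
    obtain ⟨x, hxg, hx⟩ := hgΛ
    set z := Sym2.Mem.other hxg with hz_def
    have hf : ends g = s(x, z) := (Sym2.other_spec hxg).symm
    by_cases hz : Conn ends (fun e => decide (p e = 1)) o z
    · rw [r21_T_internal_edge p ends s y o u x z g hf hx hz hg1]
      have h0 := (ih (Function.update p g 0) (hp.update g le_rfl zero_le_one)
        (card_unpinned_update_lt p g hg0 hg1 0 (Or.inl rfl)) s y o u).1
      linarith
    · by_cases hsingle : ∀ e, e ≠ g → (∃ v ∈ ends e, Conn ends (fun e => decide (p e = 1)) o v) → p e = 0 ∨ p e = 1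
      · exact r21_T_nonneg_of_single_edge p hp ends s y o u x z g hf hx hz hg1 hsingle
          ((ih (Function.update p g 0) (hp.update g le_rfl zero_le_one)
            (card_unpinned_update_lt p g hg0 hg1 0 (Or.inl rfl)) s y z u).1)
      · rw [not_forall] at hsingle
        obtain ⟨f, hf⟩ := hsingle
        rw [Classical.not_imp, Classical.not_imp, not_or] at hf
        obtain ⟨hfg, hfΛ, hf0, hf1⟩ := hf
        have hfΛ' : ∃ v ∈ ends f, Conn ends (fun e => decide (p e = 1)) o v := hfΛ
        rw [r21_T_eq_bernstein_two p ends s y o u f g hfg]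
        have hg0' : Function.update p f 0 g = p g := Function.update_of_ne hfg.symm _ _
        have hg1' : Function.update p f 1 g = p g := Function.update_of_ne hfg.symm _ _
        have h0 : 0 ≤ (prob (Function.update (Function.update p f 0) g 0) (connEvent ends s u ∩ clusterInEvent ends s {W : Set V | o ∈ W} ∩ (connEvent ends s y)ᶜ) + prob (Function.update (Function.update p f 0) g 1) (connEvent ends s u ∩ clusterInEvent ends s {W : Set V | o ∈ W} ∩ (connEvent ends s y)ᶜ) + prob (Function.update (Function.update p f 0) g 0) (connEvent ends s u ∩ connEvent ends y o ∩ (connEvent ends s y)ᶜ) + prob (Function.update (Function.update p f 0) g 1) (connEvent ends s u ∩ connEvent ends y o ∩ (connEvent ends s y)ᶜ) + prob (Function.update (Function.update p f 0) g 0) ((connEvent ends s y)ᶜ) * prob (Function.update (Function.update p f 0) g 1) (connEvent ends s u ∩ clusterInEvent ends s {W : Set V | o ∈ W}) + prob (Function.update (Function.update p f 0) g 1) ((connEvent ends s y)ᶜ) * prob (Function.update (Function.update p f 0) g 0) (connEvent ends s u ∩ clusterInEvent ends s {W : Set V | o ∈ W}) - (prob (Function.update (Function.update p f 0) g 0) (connEvent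 ends s u ∩ (connEvent ends s y)ᶜ) * prob (Function.update (Function.update p f 0) g 1) (clusterInEvent ends s {W : Set V | o ∈ W}) + prob (Function.update (Function.update p f 0) g 1) (connEvent ends s u ∩ (connEvent ends s y)ᶜ) * prob (Function.update (Function.update p f 0) g 0) (clusterInEvent ends s {W : Set V | o ∈ W}) + prob (Function.update (Function.update p f 0) g 0) (clusterInEvent ends s {W : Set V | o ∈ W} ∩ (connEvent ends s y)ᶜ) * prob (Function.update (Function.update p f 0) g 1) (connEvent ends s u) + prob (Function.update (Function.update p f 0) g 1) (clusterInEvent ends s {W : Set V | o ∈ W} ∩ (connEvent ends s y)ᶜ) * prob (Function.update (Function.update p f 0) g 0) (connEvent ends s u) + prob (Function.update (Function.update p f 0) g 0) (connEvent ends y o ∩ (connEvent ends s y)ᶜ) * prob (Function.update (Function.update p f 0) g 1) (connEvent ends s u) + prob (Function.update (Function.update p f 0) g 1) (connEvent ends y o ∩ (connEvent ends s y)ᶜ) * prob (Function.update (Function.update p f 0) g 0) (connEvent ends s u))) := by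
          refine (ih (Function.update p f 0) (hp.update f le_rfl zero_le_one)
            (card_unpinned_update_lt p f hf0 hf1 0 (Or.inl rfl)) s y o u).2 g ?_ (by rw [hg0']; exact hg0)
            (by rw [hg0']; exact hg1)
          rw [pinned_update_zero_eq p f hf1]
          exact ⟨x, hxg, hx⟩
        have h1 : 0 ≤ (prob (Function.update (Function.update p f 1) g 0) (connEvent ends s u ∩ clusterInEvent ends s {W : Set V | o ∈ W} ∩ (connEvent ends s y)ᶜ) + prob (Function.update (Function.update p f 1) g 1) (connEvent ends s u ∩ clusterInEvent ends s {W : Set V | o ∈ W} ∩ (connEvent ends s y)ᶜ) + prob (Function.update (Function.update p f 1) g 0) (connEvent ends s u ∩ connEvent ends y o ∩ (connEvent ends s y)ᶜ) + prob (Function.update (Function.update p f 1) g 1) (connEvent ends s u ∩ connEvent ends y o ∩ (connEvent ends s y)ᶜ) + prob (Function.update (Function.update p f 1) g 0) ((connEvent ends s y)ᶜ) * prob (Function.update (Function.update p f 1) g 1) (connEvent ends s u ∩ clusterInEvent ends s {W : Set V | o ∈ W}) + prob (Function.update (Function.update p f 1) g 1) ((connEvent ends s y)ᶜ) * prob (Function.update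 (Function.update p f 1) g 0) (connEvent ends s u ∩ clusterInEvent ends s {W : Set V | o ∈ W}) - (prob (Function.update (Function.update p f 1) g 0) (connEvent ends s u ∩ (connEvent ends s y)ᶜ) * prob (Function.update (Function.update p f 1) g 1) (clusterInEvent ends s {W : Set V | o ∈ W}) + prob (Function.update (Function.update p f 1) g 1) (connEvent ends s u ∩ (connEvent ends s y)ᶜ) * prob (Function.update (Function.update p f 1) g 0) (clusterInEvent ends s {W : Set V | o ∈ W}) + prob (Function.update (Function.update p f 1) g 0) (clusterInEvent ends s {W : Set V | o ∈ W} ∩ (connEvent ends s y)ᶜ) * prob (Function.update (Function.update p f 1) g 1) (connEvent ends s u) + prob (Function.update (Function.update p f 1) g 1) (clusterInEvent ends s {W : Set V | o ∈ W} ∩ (connEvent ends s y)ᶜ) * prob (Function.update (Function.update p f 1) g 0) (connEvent ends s u) + prob (Function.update (Function.update p f 1) g 0) (connEvent ends y o ∩ (connEvent ends s y)ᶜ) * prob (Function.update (Function.update p f 1) g 1) (connEvent ends s u) + prob (Function.update (Function.update p f 1) g 1) (connEvent ends y o ∩ (connEvent ends s y)ᶜ) * prob (Function.update (Function.update p f 1)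 g 0) (connEvent ends s u))) := by
          refine (ih (Function.update p f 1) (hp.update f zero_le_one le_rfl)
            (card_unpinned_update_lt p f hf0 hf1 1 (Or.inr rfl)) s y o u).2 g ?_ (by rw [hg1']; exact hg0)
            (by rw [hg1']; exact hg1)
          exact ⟨x, hxg, conn_mono (pinned_le_update_one p f) hx⟩
        have hM' := hM p hp s y o u f g hfg hfΛ' hf0 hf1 ⟨x, hxg, hx⟩ hg0 hg1 h0 h1
        exact r21_step_algebra_T (hp.nonneg f) (hp.le_one f) h0 h1 hM'
  refine ⟨?_, hT⟩
  by_cases hex : ∃ e, (∃ v ∈ ends e, Conn ends (fun e => decide (p e = 1)) o v) ∧ p e ≠ 0 ∧ p e ≠ 1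
  · obtain ⟨f, hfΛ, hf0, hf1⟩ := hex
    rw [r21_slack_eq_bernstein p ends s y o u f]
    exact r21_step_algebra_T (hp.nonneg f) (hp.le_one f)
      (ih (Function.update p f 0) (hp.update f le_rfl zero_le_one)
        (card_unpinned_update_lt p f hf0 hf1 0 (Or.inl rfl)) s y o u).1
      (ih (Function.update p f 1) (hp.update f zero_le_one le_rfl)
        (card_unpinned_update_lt p f hf0 hf1 1 (Or.inr rfl)) s y o u).1
      (hT f hfΛ hf0 hf1)
  · have hpin : ∀ e, (∃ v ∈ ends e, Conn ends (fun e => decide (p e = 1)) o v) → p e = 0 ∨ p e = 1 := by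
      intro e he
      by_contra hne
      exact hex ⟨e, he, fun h => hne (Or.inl h), fun h => hne (Or.inr h)⟩
    rw [r21_slack_eq_zero_of_explored_o p hp ends s y o u hpin]


end NestedFrame

end Summit.Ventures.PercRepro2
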